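import Summits.BirchSwinnertonDyer.BirchSwinnertonDyer.Theorems.UniversalToricDescentRoadFFPerLevelDescent
import Summits.BirchSwinnertonDyer.BirchSwinnertonDyer.Theorems.UniversalToricDescentRoadFFDescentOddRational
import Summits.BirchSwinnertonDyer.BirchSwinnertonDyer.Theorems.UniversalToricDescentTwinTorsionRankOne
import HarnessLib

/-!
# Route `UniversalToricDescent`, ♭B column (`TwinSplitIMCAtThreeMult` 20694 / ♭B_T `TwinWanFrameAtThreeMultT` 27172), line
# `membertower`: the Road-FF descent at the 3-multiplicative twin from a member tower with PER-LEVEL exponents `e_m`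
# (no `m`-uniformity; `limsup (m − e_m) = ∞`) and `μ(L) = 0` — the K1b brick N1 of memo MEMBER-INCLUSION-AT3-g12 at the twin

Cell `bsd-wall` (run/shared/lean/pub/bsd-wall/), seat `bsd-wall-utd-p2` (lead prover g12, 2026-08-28);
`--supports stmt-BirchSwinnertonDyer-20694 --as helper`; Theses-free.

§1 `AcSelmer.XAc.map_fittingIdeal_le_span_of_oneSided_congruences_descent_le_printed_perLevel` — p612782's XAc-level
member limit in the PRINTED shape (twist pre-mapped, as p613851's `…_printed'`) with the twist `p^{e_m}` varying with the level, UNTWISTED (conclusion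
`Fitt₀_Λ(X^Σ)·R₀⟦T⟧ ⊆ (L^Σ)`) under `p`-avoidance of `L^Σ` and `∀ n ∃ m ≥ 1, e_m + n ≤ m` (abstract limit p624148).
§2 `P2.RoadFF.exists_map_span_C_pow_mul_fittingIdeal_le_of_perLevelMemberTower_odd` — the twin/erratum kernel at odd `p`
(= p616714's `…_of_rationalMemberTower_odd` with `e : ℕ → ℕ`): for `μ(L) = 0` (a unit coefficient) the conclusion is
`∃ t, (C(p)^t·Fitt₀_Λ(X^Σ))·R₀⟦T⟧ ⊆ (L·P_Σ)` with `t = μ(P_Σ) < ∞` (`P_Σ ≠ 0`; finite-`μ` split by `WfDvdMonoid.max_power_factor`;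
the descent runs against `L·P′`, `P_Σ = p^t·P′`, `p ∤ L·P′`). §3 the twin at `p = 3`: ♭B / ♭B_T's `∃ k`-clause with `k = t`
(p612782's twisted recombination). HONEST FRAMING: theorems only; CONDITIONAL on Shapiro (PUBLISHED), the per-level member
tower (RESEARCH, port-shaped), `μ(L) = 0` (Hsieh 2014 Thm. B at the twin, PUBLISHED by name), the `Σ`-data / torsion and (dec);
nothing booked; BSD is proved for no curve. References: [Skinner2016PacificMC] §3.1; [Castella2018Erratum] proof of Thm. 1.1 (p. 4);
[Hsieh2014] Thm. B; [StacksProject] Tags 05GI, 07ZA.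
-/

set_option linter.dupNamespace false
set_option autoImplicit false

noncomputable section


open scoped TensorProduct Classical

open CategoryTheory PowerSeries NumberField IsDedekindDomain Field WeierstrassCurve
open Literature.NumberTheory.GaloisRepresentations Literature.NumberTheory.EllipticCurves
  Literature.NumberTheory.EllipticCurves.BigGaloisRep Literature.NumberTheory.EllipticCurves.GreenbergSelmer
  Literature.NumberTheory.EllipticCurves.Skinner2016 Literature.NumberTheory.EllipticCurves.Rank1Residual
  Literature.NumberTheory.EllipticCurves.Rank1Residual.Typed Literature.NumberTheory.EllipticCurves.ModularForms
  Literature.NumberTheory.EllipticCurves.Castella2018 Literature.RingTheory.FittingIdeal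
  Literature.NumberTheory.EllipticCurves.Module
open Summit.BirchSwinnertonDyer.Rank1Residual.X11b.Halves Summit.BirchSwinnertonDyer.Rank1Residual.X11b.AcSelmer
  Summit.BirchSwinnertonDyer.Rank1Residual.X2
open Summit.BirchSwinnertonDyer.BirchSwinnertonDyer.Theorems (exists_span_C_pow_mul_span_le_fittingIdeal_zero)

namespace Summit.BirchSwinnertonDyer.Rank1Residual.X11b

/-! ### §1 The untwisted per-level member limit on `X^Σ` -/

section XAc

variable {K : Type} [Field K] [NumberField K] (E : WeierstrassCurve K) [E.IsElliptic]
  (p : ℕ) [Fact p.Prime] (κ : ZpExtension K p) (𝔭 : HeightOneSpectrum (𝓞 K))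
  {S : Set (HeightOneSpectrum (𝓞 K))} (γ : Field.absoluteGaloisGroup K) [Fact (κ.IsTopGenerator γ)]

universe v w

/-- **The member limit ON `X^Σ` at the Fitting level, members in the PRINTED shape, twisted AT LEVEL `m` by `p^{e_m}`,
UNTWISTED.** As p612782's `…_descent_le_printed` but the rational member inclusions read «`N_m` torsion →
`(p^{e_m}·Ch_{R'_m}(N_m))·S'_m ⊆ (L_m)`» with an exponent depending on the level, `∀ n ∃ m ≥ 1, e_m + n ≤ m`, and `L^Σ`
avoids `p` in `R₀⟦T⟧` (`p·y ∈ (L^Σ) ⇒ y ∈ (L^Σ)`, e.g. `p ∤ L^Σ`). THEN `Fitt₀_Λ(X^Σ)·R₀⟦T⟧ ⊆ (L^Σ)` (no twist left).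
[cite: Skinner2016PacificMC, §2.6, §3.1 (p. 192)] [cite: Castella2018Erratum, (2.5) and proof of Thm. 1.1 (p. 4), read one-sidedly] -/
theorem AcSelmer.XAc.map_fittingIdeal_le_span_of_oneSided_congruences_descent_le_printed_perLevel
    (hS : S.Finite) (e : ℕ → ℕ) (hunb : ∀ n : ℕ, ∃ m : ℕ, 1 ≤ m ∧ e m + n ≤ m) (LS : UnrSeries p)
    (hav : ∀ y : UnrSeries p, (C ((p : ℕ) : unrIntegers p) : UnrSeries p) * y ∈ Ideal.span ({LS} : Set (UnrSeries p)) →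
      y ∈ Ideal.span ({LS} : Set (UnrSeries p)))
    (R' : ℕ → Type v) [∀ m, CommRing (R' m)]
    [∀ m, IsNoetherianRing (R' m)] [∀ m, IsDomain (R' m)] [∀ m, UniqueFactorizationMonoid (R' m)]
    [∀ m, Algebra (IwasawaAlgebra p) (R' m)]
    (S' : ℕ → Type w) [∀ m, CommRing (S' m)] [∀ m, Algebra (UnrSeries p) (S' m)]
    [∀ m, Module.FaithfullyFlat (UnrSeries p) (S' m)] (φ' : ∀ m, R' m →+* S' m)
    (hφ' : ∀ m, (φ' m).comp (algebraMap (IwasawaAlgebra p) (R' m)) =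
      (algebraMap (UnrSeries p) (S' m)).comp (PowerSeries.map (toUnr p)))
    (N : ℕ → Type) [∀ m, AddCommGroup (N m)] [∀ m, Module (R' m) (N m)]
    [∀ m, Module.Finite (R' m) (N m)] (Lm : ∀ m, S' m)
    (eqv : ∀ m : ℕ, 1 ≤ m →
      (((R' m ⊗[IwasawaAlgebra p] XAc E p κ 𝔭 S γ) ⧸
          (((Ideal.span {(PowerSeries.C (p : ℤ_[p]) : IwasawaAlgebra p)}).map
              (algebraMap (IwasawaAlgebra p) (R' m))) ^ m •
            (⊤ : Submodule (R' m) (R' m ⊗[IwasawaAlgebra p] XAc E p κ 𝔭 S γ)))) ≃ₗ[R' m]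
        (N m ⧸ (((Ideal.span {(PowerSeries.C (p : ℤ_[p]) : IwasawaAlgebra p)}).map
            (algebraMap (IwasawaAlgebra p) (R' m))) ^ m • (⊤ : Submodule (R' m) (N m))))))
    (hCh : ∀ m : ℕ, 1 ≤ m → Module.IsTorsion (R' m) (N m) →
      Ideal.span {φ' m (algebraMap (IwasawaAlgebra p) (R' m) ((PowerSeries.C (p : ℤ_[p]) : IwasawaAlgebra p) ^ e m))} *
          (Module.charIdeal (R' m) (N m)).map (φ' m) ≤ Ideal.span {Lm m})
    (hc : ∀ m : ℕ, 1 ≤ m →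
      Ideal.span {Lm m} ≤
        Ideal.span {algebraMap (UnrSeries p) (S' m) LS} ⊔
          (((Ideal.span {(PowerSeries.C (p : ℤ_[p]) : IwasawaAlgebra p)}).map
              (PowerSeries.map (toUnr p))).map (algebraMap (UnrSeries p) (S' m))) ^ m) :
    (Module.fittingIdeal (IwasawaAlgebra p) (XAc E p κ 𝔭 S γ) 0).map (PowerSeries.map (toUnr p)) ≤
      Ideal.span {LS} := by
  haveI : Module.Finite (IwasawaAlgebra p) (XAc E p κ 𝔭 S γ) := XAc.module_finite κ 𝔭 S γ hS
  haveI := HidaLimitAlgebra.isNoetherianRing_unrSeries (p := p)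
  have hI : (Ideal.span {(PowerSeries.C (p : ℤ_[p]) : IwasawaAlgebra p)}).map
      (PowerSeries.map (toUnr p)) ≤ (⊥ : Ideal (UnrSeries p)).jacobson := by
    rw [HidaLimitAlgebra.map_span_C_p]
    exact HidaLimitAlgebra.span_C_p_le_jacobson_unrSeries
  have hφp : (PowerSeries.map (toUnr p)) (PowerSeries.C (p : ℤ_[p]) : IwasawaAlgebra p) =
      (C ((p : ℕ) : unrIntegers p) : UnrSeries p) := by
    rw [PowerSeries.map_C, map_natCast]
  exact CongruenceDescent.map_le_span_of_oneSided_congruences_descent_le_perLevel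
    (PowerSeries.map (toUnr p)) (PowerSeries.C (p : ℤ_[p]) : IwasawaAlgebra p) hI (le_refl _) LS
    (by rw [hφp]; exact hav) e hunb R' S' φ' hφ' N Lm eqv
    (fun m hm ↦ CongruenceDescent.map_span_mul_fittingIdeal_le_of_printed_charIdeal_le (φ' m)
      (algebraMap (IwasawaAlgebra p) (R' m) ((PowerSeries.C (p : ℤ_[p]) : IwasawaAlgebra p) ^ e m))
      (fun hT ↦ by
        rw [Ideal.map_mul, Ideal.map_span, Set.image_singleton]
        exact hCh m hm hT)) hc

end XAc


/-! ### §2 The per-level twin/erratum kernel at odd `p` -/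

open RoadFFMember Summit.BirchSwinnertonDyer.BirchSwinnertonDyer.Theorems

set_option maxHeartbeats 800000 in
/-- **ROAD FF DESCENT KERNEL AT ANY ODD PRIME FROM A RATIONAL MEMBER TOWER WITH PER-LEVEL EXPONENTS** (= p616714's
`P2.RoadFF.map_span_C_pow_mul_fittingIdeal_le_of_rationalMemberTower_odd` with the `m`-UNIFORM exponent `e` replaced by a
sequence `e_m` subject only to `∀ n ∃ m ≥ 1, e_m + n ≤ m`, at the price of `μ(L) = 0` — a unit coefficient of `L`, Hsieh
2014 Thm. B at the form `f` by name). For a globally minimal `E/ℚ`, `p ≥ 3` with `E[p]` irreducible and `p ∥ N`, `K` imaginary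
quadratic with `p` split, the X-slot `𝔭bar ∋ p`, (dec), `L ∈ R₀⟦T⟧` with a unit coefficient, and for every `m ≥ 1` a Hida
member whose `Σ`-imprimitive Selmer dual satisfies, in every receptacle, «torsion → `(p^{e_m}·Ch(X^Σ_ac(A_{g_m})))·S₀⟦T⟧ ⊆ (L_m)`»
and (c) «`(L_m) ⊆ (L·P_Σ) + (p^m)`»: then `(C(p)^t·Fitt₀_Λ(X^Σ_ac(E; slot 𝔭bar)))·R₀⟦T⟧ ⊆ (L·P_Σ)` for SOME `t` (namely
`t = μ(P_Σ)`, finite since `P_Σ ≠ 0`: write `P_Σ = p^t·P′` with `p ∤ P′` by `WfDvdMonoid.max_power_factor`, run the UNTWISTED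
per-level limit of §1 against `L·P′`, which avoids `p`). Assembly verbatim p616714's. CONDITIONAL on Shapiro `hSh` (PUBLISHED)
and on the per-level rational member tower (RESEARCH, port-shaped); nothing is booked; BSD is proved for no curve.
[cite: Castella2018Erratum, (b), (c), Lemma 2.1, (2.5) and proof of Thm. 1.1 (pp. 2–4)]
[cite: Skinner2016PacificMC, §2.3 (p. 179), §2.6 (2-6-1), §3.1 (p. 192)] [cite: SkinnerUrban2014, Prop. 3.2.3, Lemma 3.1.9]
[cite: Hsieh2014, Thm. B (the unit coefficient of `L`)] [cite: YanZhu2026, Cor. 4.6 (the `S⁻¹`-shape of the member inclusion)] -/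
theorem P2.RoadFF.exists_map_span_C_pow_mul_fittingIdeal_le_of_perLevelMemberTower_odd
    (hSh : SkinnerUrban2014.prop323_XAc_equiv_XBigDecomp)
    (W : WeierstrassCurve ℚ) [W.IsElliptic] [W.IsGloballyMinimal] (p : ℕ) [Fact p.Prime] (hp : 3 ≤ p)
    (K : Type) [Field K] [NumberField K] (hK : IsImaginaryQuadratic K) (hirr : Irr W p) (hmult : Mult W p)
    (hsp : SplitsIn K p) (hiv : ∀ Q : (W.baseChange ℚ_[p]).toAffine.Point, p • Q = 0 → Q = 0)
    (κ : ZpExtension K p) (hκ : κ.IsAnticyclotomic) (γ : Field.absoluteGaloisGroup K) [Fact (κ.IsTopGenerator γ)]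
    (𝔭bar : HeightOneSpectrum (𝓞 K)) (h𝔭bar : ((p : ℕ) : 𝓞 K) ∈ 𝔭bar.asIdeal)
    (L : UnrSeries p) (hμL : ∃ i : ℕ, IsUnit (PowerSeries.coeff i L))
    (e : ℕ → ℕ) (hunb : ∀ n : ℕ, ∃ m : ℕ, 1 ≤ m ∧ e m + n ≤ m)
    (hmem : ∀ m : ℕ, 1 ≤ m →
      ∃ D : Skinner2016.HidaCongruentMember W p m,
        ∀ [TopologicalSpace (PowerSeries (padicCoeffIntegers D.ι))]
          [ContinuousSMul (PowerSeries (padicCoeffIntegers D.ι))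
            (BigRepModule (padicCoeffIntegers D.ι) p (Cofree D.Δ.ρ (padicCoeffField D.ι)))],
        ∀ (S₀ : Type) [CommRing S₀] (a : unrIntegers p →+* S₀) (b : padicCoeffIntegers D.ι →+* S₀)
          (j : ℤ_[p] →+* unrIntegers p),
          (∀ x : ℤ_[p], ((j x : unrIntegers p) : ℂ_[p]) = algebraMap ℚ_[p] ℂ_[p] (x : ℚ_[p])) →
          a.comp j = b.comp (algebraMap ℤ_[p] (padicCoeffIntegers D.ι)) →
          ∃ Lm : PowerSeries S₀,
            (Module.IsTorsion (PowerSeries (padicCoeffIntegers D.ι))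
                (XBig κ (D.Δ.cofreeRepOver K) 𝔭bar (↑(W.sigmaPlacesFinset p K))) →
              Ideal.span {((p : ℕ) : PowerSeries S₀) ^ e m} *
                  (XBig.charIdeal κ (D.Δ.cofreeRepOver K) 𝔭bar (↑(W.sigmaPlacesFinset p K))).map
                    (PowerSeries.map b) ≤ Ideal.span {Lm}) ∧
            Ideal.span {Lm} ≤
              Ideal.span {PowerSeries.map a (L * PowerSeries.map j (W.sigmaEulerElement p K κ))} ⊔
                Ideal.span {((p : ℕ) : PowerSeries S₀) ^ m}) :
    ∃ t : ℕ, (Ideal.span {(PowerSeries.C (p : ℤ_[p]) : IwasawaAlgebra p) ^ t} *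
        Module.fittingIdeal (IwasawaAlgebra p)
          (AcSelmer.XAc (W.baseChange K) p κ 𝔭bar
            (↑(W.sigmaPlacesFinset p K) : Set (HeightOneSpectrum (𝓞 K))) γ) 0).map (PowerSeries.map (toUnr p)) ≤
      Ideal.span {L * PowerSeries.map (toUnr p) (W.sigmaEulerElement p K κ)} := by
  -- ### elementary consequences of the binders
  have hpN : p ∣ W.conductorNorm ℤ := dvd_conductorNorm_of_mult hmult
  have hN0 : W.conductorNorm ℤ ≠ 0 := (W.conductorNorm_pos_holds).ne'
  have hpM : ¬ p ∣ W.conductorNorm ℤ / p := by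
    have hfac := W.factorization_conductorNorm_eq_one_of_hasMultiplicativeReductionAtPrime p hmult
    intro h
    have h2 : p ^ 2 ∣ W.conductorNorm ℤ := by
      rw [pow_two]
      exact Nat.mul_dvd_of_dvd_div hpN h
    have := ((Fact.out : p.Prime).pow_dvd_iff_le_factorization hN0).mp h2
    omega
  have hMpos : 0 < W.conductorNorm ℤ / p :=
    Nat.div_pos (Nat.le_of_dvd (Nat.pos_of_ne_zero hN0) hpN) (Fact.out : p.Prime).pos
  haveI : NeZero (W.conductorNorm ℤ / p) := ⟨hMpos.ne'⟩
  have hHp : SatisfiesHeegnerHypothesis p K := satisfiesHeegnerHypothesis_of_splitsIn Fact.out hsp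
  -- ### `Σ`
  have hSfin : (↑(W.sigmaPlacesFinset p K) : Set (HeightOneSpectrum (𝓞 K))).Finite :=
    (W.sigmaPlacesFinset p K).finite_toSet
  have hSp : ∀ w ∈ (↑(W.sigmaPlacesFinset p K) : Set (HeightOneSpectrum (𝓞 K))),
      ((p : ℕ) : 𝓞 K) ∉ w.asIdeal :=
    fun w hw => W.forall_mem_sigmaPlacesFinset_not_mem p K w (Finset.mem_coe.1 hw)
  have hS : ∀ w : HeightOneSpectrum (𝓞 K), w ∉ (↑(W.sigmaPlacesFinset p K) : Set (HeightOneSpectrum (𝓞 K))) →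
      ((p : ℕ) : 𝓞 K) ∉ w.asIdeal → (W.baseChange K).HasGoodReductionAt w := by
    intro w hw hwp
    rw [WeierstrassCurve.coe_sigmaPlacesFinset] at hw
    exact WeierstrassCurve.hasGoodReductionAt_baseChange_of_not_mem_sigmaPlaces hw hwp
  have hSM : ∀ w : HeightOneSpectrum (𝓞 K), w ∉ (↑(W.sigmaPlacesFinset p K) : Set (HeightOneSpectrum (𝓞 K))) →
      ((W.conductorNorm ℤ / p : ℕ) : 𝓞 K) ∉ w.asIdeal := by
    intro w hw hM'
    rw [WeierstrassCurve.coe_sigmaPlacesFinset] at hw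
    exact hw (WeierstrassCurve.mem_sigmaPlaces_of_tameLevel_mem hpN hpM hM')
  -- ### `K_{𝔭bar} → ℚ_p`
  obtain ⟨heb, hfb⟩ := degreeOne_of_splitsIn hK.1 hsp h𝔭bar
  obtain ⟨φ⟩ := AcSelmer.exists_ringHom_adicCompletion_padic_of_degreeOne p 𝔭bar h𝔭bar heb hfb
  -- ### a member at every level `max m 1`
  choose Dm hDm using fun m : ℕ => hmem (max m 1) (le_max_right m 1)
  -- ### topologies and coefficient-ring instances
  letI : TopologicalSpace (IwasawaAlgebra p) := ⊥
  haveI : DiscreteTopology (IwasawaAlgebra p) := ⟨rfl⟩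
  letI τ : ∀ m : ℕ, TopologicalSpace (PowerSeries (padicCoeffIntegers (Dm m).ι)) := fun _ => ⊥
  haveI : ∀ m : ℕ, DiscreteTopology (PowerSeries (padicCoeffIntegers (Dm m).ι)) := fun _ => ⟨rfl⟩
  haveI : ∀ m : ℕ, IsPrincipalIdealRing (padicCoeffIntegers (Dm m).ι) := fun m =>
    (Dm m).isPrincipalIdealRing_coeffRing
  haveI : ∀ m : ℕ, Module.Free ℤ_[p] (padicCoeffIntegers (Dm m).ι) := fun m => (Dm m).moduleFree_coeffRing
  haveI : ∀ m : ℕ, Module.Finite ℤ_[p] (padicCoeffIntegers (Dm m).ι) := fun m =>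
    (Dm m).moduleFinite_coeffRing
  letI : Algebra ℤ_[p] (unrIntegers p) := (toUnr p).toAlgebra
  have hj : algebraMap ℤ_[p] (unrIntegers p) = toUnr p := rfl
  haveI : ∀ m : ℕ, Module.FaithfullyFlat (UnrSeries p)
      (PowerSeries (unrIntegers p ⊗[ℤ_[p]] padicCoeffIntegers (Dm m).ι)) := fun m =>
    faithfullyFlat_receptacle p (padicCoeffIntegers (Dm m).ι)
  -- the receptacle clause of every member: the RATIONAL (2.5)_m under the torsion premise, and (c)
  have hrec : ∀ m : ℕ, ∃ Lm : PowerSeries (unrIntegers p ⊗[ℤ_[p]] padicCoeffIntegers (Dm m).ι),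
      (Module.IsTorsion (PowerSeries (padicCoeffIntegers (Dm m).ι))
          (XBig κ ((Dm m).Δ.cofreeRepOver K) 𝔭bar (↑(W.sigmaPlacesFinset p K) : Set (HeightOneSpectrum (𝓞 K)))) →
        Ideal.span {((p : ℕ) : PowerSeries (unrIntegers p ⊗[ℤ_[p]] padicCoeffIntegers (Dm m).ι)) ^ e (max m 1)} *
          (XBig.charIdeal κ ((Dm m).Δ.cofreeRepOver K) 𝔭bar
            (↑(W.sigmaPlacesFinset p K) : Set (HeightOneSpectrum (𝓞 K)))).map
            (PowerSeries.map (Algebra.TensorProduct.includeRight (R := ℤ_[p]) (A := unrIntegers p)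
              (B := padicCoeffIntegers (Dm m).ι)).toRingHom) ≤ Ideal.span {Lm}) ∧
        Ideal.span {Lm} ≤
          Ideal.span {PowerSeries.map (algebraMap (unrIntegers p)
              (unrIntegers p ⊗[ℤ_[p]] padicCoeffIntegers (Dm m).ι))
              (L * PowerSeries.map (toUnr p) (W.sigmaEulerElement p K κ))} ⊔
            Ideal.span {((p : ℕ) : PowerSeries (unrIntegers p ⊗[ℤ_[p]] padicCoeffIntegers (Dm m).ι)) ^
              (max m 1)} :=
    fun m => hDm m _ (algebraMap _ _) _ (toUnr p) (coe_toUnr p)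
      (algebraMap_comp_toUnr_eq p (padicCoeffIntegers (Dm m).ι) hj)
  choose Lm hLm using hrec
  -- finite generation of `X^Σ_ac(A_{g_m})` over `Λ_{𝒪_m}`
  haveI : ∀ m : ℕ, Module.Finite (PowerSeries (padicCoeffIntegers (Dm m).ι))
      (XBig κ ((Dm m).Δ.cofreeRepOver K) 𝔭bar (↑(W.sigmaPlacesFinset p K) : Set (HeightOneSpectrum (𝓞 K)))) :=
    fun m =>
      haveI := (Dm m).finiteDimensional_padicCoeffField
      SkinnerUrban2014.moduleFinite_XBig_of_lemma319 SkinnerUrban2014.lemma319_finite_XBig_holds κ 𝔭bar _ hSfin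
        ((Dm m).Δ.cofreeRepOver K)
        (GreenbergSelmer.Cofree.exists_pow_psmul_eq_zero (Dm m).ι (Dm m).Δ.ρ)
        (GreenbergSelmer.Cofree.divisible (padicCoeffField (Dm m).ι) (Dm m).Δ.ρ (Fact.out : p.Prime).ne_zero)
        (GreenbergSelmer.Cofree.finite_setOf_psmul_eq_zero (Dm m).ι (Dm m).Δ.ρ)
        (GreenbergSelmer.OrdinaryNewformDatum.cofreeRepOver_localMap_inr_apply_eq_self (Dm m).Δ K _ hSM)
  -- ### the member congruences `e_m` at `3 ≤ p`
  have hEm : ∀ m : ℕ, 1 ≤ m →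
      Nonempty ((((PowerSeries (padicCoeffIntegers (Dm m).ι)) ⊗[IwasawaAlgebra p]
            AcSelmer.XAc (W.baseChange K) p κ 𝔭bar (↑(W.sigmaPlacesFinset p K) : Set (HeightOneSpectrum (𝓞 K))) γ) ⧸
          (((Ideal.span {(C (p : ℤ_[p]) : IwasawaAlgebra p)}).map
              (algebraMap (IwasawaAlgebra p) (PowerSeries (padicCoeffIntegers (Dm m).ι)))) ^ m •
            (⊤ : Submodule (PowerSeries (padicCoeffIntegers (Dm m).ι))
              ((PowerSeries (padicCoeffIntegers (Dm m).ι)) ⊗[IwasawaAlgebra p]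
                AcSelmer.XAc (W.baseChange K) p κ 𝔭bar (↑(W.sigmaPlacesFinset p K) : Set (HeightOneSpectrum (𝓞 K))) γ))))
          ≃ₗ[PowerSeries (padicCoeffIntegers (Dm m).ι)]
        (XBig κ ((Dm m).Δ.cofreeRepOver K) 𝔭bar (↑(W.sigmaPlacesFinset p K) : Set (HeightOneSpectrum (𝓞 K))) ⧸
          (((Ideal.span {(C (p : ℤ_[p]) : IwasawaAlgebra p)}).map
              (algebraMap (IwasawaAlgebra p) (PowerSeries (padicCoeffIntegers (Dm m).ι)))) ^ m •
            (⊤ : Submodule (PowerSeries (padicCoeffIntegers (Dm m).ι))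
              (XBig κ ((Dm m).Δ.cofreeRepOver K) 𝔭bar (↑(W.sigmaPlacesFinset p K) : Set (HeightOneSpectrum (𝓞 K)))))))) := by
    intro m hm
    exact nonempty_quotPow_congr_of_eq _ (max_eq_left hm)
      (nonempty_memberCongruence_odd_of_facts hSh Skinner2016.selmerBig_extendScalars_equiv_baseChange_holds hp
        hirr hK hHp 𝔭bar h𝔭bar φ hiv _ hSfin hSp hS hSM κ hκ γ (Dm m) (le_max_right m 1)).some
  -- ### the twisting element `C(p)^e` and its image `p^e` in every receptacle
  have hCp : (PowerSeries.C (p : ℤ_[p]) : IwasawaAlgebra p) = ((p : ℕ) : IwasawaAlgebra p) := map_natCast _ p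
  have htw : ∀ m : ℕ,
      (PowerSeries.map (Algebra.TensorProduct.includeRight (R := ℤ_[p]) (A := unrIntegers p)
          (B := padicCoeffIntegers (Dm m).ι)).toRingHom)
        (algebraMap (IwasawaAlgebra p) (PowerSeries (padicCoeffIntegers (Dm m).ι))
          ((PowerSeries.C (p : ℤ_[p]) : IwasawaAlgebra p) ^ e (max m 1))) =
      ((p : ℕ) : PowerSeries (unrIntegers p ⊗[ℤ_[p]] padicCoeffIntegers (Dm m).ι)) ^ e (max m 1) := by
    intro m
    rw [hCp, map_pow, map_pow, map_natCast, map_natCast]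
  -- ### (c), one-sided, with `(p^m)` in the consumer's spelling
  have hc' : ∀ m : ℕ, 1 ≤ m →
      Ideal.span {Lm m} ≤
        Ideal.span {algebraMap (UnrSeries p) (PowerSeries (unrIntegers p ⊗[ℤ_[p]] padicCoeffIntegers (Dm m).ι))
            (L * PowerSeries.map (toUnr p) (W.sigmaEulerElement p K κ))} ⊔
          (((Ideal.span {(C (p : ℤ_[p]) : IwasawaAlgebra p)}).map (PowerSeries.map (toUnr p))).map
            (algebraMap (UnrSeries p) (PowerSeries (unrIntegers p ⊗[ℤ_[p]] padicCoeffIntegers (Dm m).ι)))) ^ m :=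
    fun m hm => span_le_sup_of_receptacle p (padicCoeffIntegers (Dm m).ι) hm _ (Lm m) (hLm m).2
  -- ### `μ(L) = 0` and the finite-`μ` split of `P_Σ`: the descent runs against `L·P′`, `P_Σ = p^t·P′`, `p ∤ L·P′`
  haveI := HidaLimitAlgebra.isNoetherianRing_unrSeries (p := p)
  have hprime : Prime (C ((p : ℕ) : unrIntegers p) : UnrSeries p) :=
    prime_C_of_prime CongruenceDescent.prime_natCast_p_unrIntegers
  have hPS0 : PowerSeries.map (toUnr p) (W.sigmaEulerElement p K κ) ≠ 0 := fun h ↦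
    W.sigmaEulerElement_ne_zero p K κ (map_toUnr_injective (by rw [h, map_zero]))
  haveI : WfDvdMonoid (UnrSeries p) := IsNoetherianRing.wfDvdMonoid
  obtain ⟨t, P', hP', hfac⟩ := WfDvdMonoid.max_power_factor hPS0 hprime.irreducible
  have hL : ¬ (C ((p : ℕ) : unrIntegers p) : UnrSeries p) ∣ L := by
    rintro ⟨M, hM⟩
    obtain ⟨i, hi⟩ := hμL
    rw [hM, PowerSeries.coeff_C_mul] at hi
    exact CongruenceDescent.prime_natCast_p_unrIntegers.not_unit (isUnit_of_mul_isUnit_left hi)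
  have hLP' : ¬ (C ((p : ℕ) : unrIntegers p) : UnrSeries p) ∣ L * P' := fun h ↦
    (hprime.dvd_or_dvd h).elim hL hP'
  have hav := Halves.avoid_of_not_C_dvd hLP'
  have hdvd : L * P' ∣ L * PowerSeries.map (toUnr p) (W.sigmaEulerElement p K κ) :=
    ⟨(C ((p : ℕ) : unrIntegers p) : UnrSeries p) ^ t, by rw [hfac]; ring⟩
  -- ### (c) against `L·P′`
  have hc'' : ∀ m : ℕ, 1 ≤ m →
      Ideal.span {Lm m} ≤
        Ideal.span {algebraMap (UnrSeries p) (PowerSeries (unrIntegers p ⊗[ℤ_[p]] padicCoeffIntegers (Dm m).ι))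
            (L * P')} ⊔
          (((Ideal.span {(C (p : ℤ_[p]) : IwasawaAlgebra p)}).map (PowerSeries.map (toUnr p))).map
            (algebraMap (UnrSeries p) (PowerSeries (unrIntegers p ⊗[ℤ_[p]] padicCoeffIntegers (Dm m).ι)))) ^ m :=
    fun m hm => (hc' m hm).trans (sup_le_sup_right
      (Ideal.span_singleton_le_span_singleton.mpr (map_dvd _ hdvd)) _)
  -- ### the per-level exponents at the indices `max m 1`
  have hunb' : ∀ n : ℕ, ∃ m : ℕ, 1 ≤ m ∧ e (max m 1) + n ≤ m := by
    intro n
    obtain ⟨m, hm, hmn⟩ := hunb n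
    exact ⟨m, hm, by rwa [max_eq_left hm]⟩
  -- ### the UNTWISTED Fitting-level member limit against `L·P′`
  have key : (Module.fittingIdeal (IwasawaAlgebra p)
      (AcSelmer.XAc (W.baseChange K) p κ 𝔭bar (↑(W.sigmaPlacesFinset p K) : Set (HeightOneSpectrum (𝓞 K))) γ) 0).map
        (PowerSeries.map (toUnr p)) ≤ Ideal.span {L * P'} := by
    refine AcSelmer.XAc.map_fittingIdeal_le_span_of_oneSided_congruences_descent_le_printed_perLevel
      (W.baseChange K) p κ 𝔭bar γ hSfin (fun m => e (max m 1)) hunb' (L * P') hav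
      (fun m => PowerSeries (padicCoeffIntegers (Dm m).ι))
      (fun m => PowerSeries (unrIntegers p ⊗[ℤ_[p]] padicCoeffIntegers (Dm m).ι))
      (fun m => PowerSeries.map (Algebra.TensorProduct.includeRight (R := ℤ_[p]) (A := unrIntegers p)
        (B := padicCoeffIntegers (Dm m).ι)).toRingHom)
      (fun m => map_includeRight_comp_algebraMap p (padicCoeffIntegers (Dm m).ι) hj)
      (fun m => XBig κ ((Dm m).Δ.cofreeRepOver K) 𝔭bar (↑(W.sigmaPlacesFinset p K) : Set (HeightOneSpectrum (𝓞 K))))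
      Lm (fun m hm => (hEm m hm).some)
      ?_ hc''
    intro m _ hTm
    have hI := congrArg (fun x : PowerSeries (unrIntegers p ⊗[ℤ_[p]] padicCoeffIntegers (Dm m).ι) =>
      Ideal.span ({x} : Set (PowerSeries (unrIntegers p ⊗[ℤ_[p]] padicCoeffIntegers (Dm m).ι)))) (htw m)
    exact (congrArg (· * _) hI).trans_le ((hLm m).1 hTm)
  -- ### re-twist by `C(p)^t`: `(C(p)^t·Fitt)·R₀⟦T⟧ ⊆ (p̄^t·L·P′) = (L·P_Σ)`
  refine ⟨t, ?_⟩
  rw [Ideal.map_mul, Ideal.map_span, Set.image_singleton, map_pow, PowerSeries.map_C, map_natCast]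
  calc Ideal.span {(C ((p : ℕ) : unrIntegers p) : UnrSeries p) ^ t} *
        (Module.fittingIdeal (IwasawaAlgebra p)
          (AcSelmer.XAc (W.baseChange K) p κ 𝔭bar (↑(W.sigmaPlacesFinset p K) : Set (HeightOneSpectrum (𝓞 K))) γ) 0).map
          (PowerSeries.map (toUnr p))
      ≤ Ideal.span {(C ((p : ℕ) : unrIntegers p) : UnrSeries p) ^ t} * Ideal.span {L * P'} :=
        Ideal.mul_mono_right key
    _ = Ideal.span {L * PowerSeries.map (toUnr p) (W.sigmaEulerElement p K κ)} := by
        rw [Ideal.span_singleton_mul_span_singleton, hfac]; ring_nf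


/-! ### §3 At the 3-multiplicative twin: the Wan clause UNDER torsion from a PER-LEVEL member tower and `μ(L) = 0` -/

/-- **PER-LEVEL MEMBER TOWER + TORSION + `μ(L) = 0` ⟹ THE RATIONAL WAN CLAUSE AT THE GIVEN FRAME (♭B_T's consequent).**
Under the binders of ♭B_T / line `membertower` plus (dec) `W′(ℚ₃)[3] = 0`: for a series `L ∈ R₀⟦T⟧` with a UNIT coefficient
(`μ(L) = 0`: at a BDP frame of `f_{W′}` this is Hsieh 2014 Thm. B, PUBLISHED by name), exponents `e_m` with `∀ n ∃ m ≥ 1,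
e_m + n ≤ m`, a Hida member tower with the RATIONAL inclusions «torsion → `(3^{e_m}·Ch)·S₀⟦T⟧ ⊆ (L_m)`» and (c), and
Λ-torsion of `X^∅_ac(W′/K_∞; slot 𝔭′)`: SOME `k` has `C(3^k)·G ∈ (L)` for every `G ∈ Ch_Λ(X^∅)·R₀⟦T⟧` (in fact `k = μ(P_Σ)`).
§2 + w2 g2's `twin_sigmaDataAt_of_isTorsion_empty'` (p613967) + p612782's twisted recombination. CONDITIONAL on Shapiro
`hSh` (PUBLISHED), the per-level member tower (RESEARCH, port-shaped), torsion and (dec); nothing is booked; BSD is proved for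
no curve. [cite: Skinner2016PacificMC, §3.1 (p. 192)] [cite: Hsieh2014, Thm. B] [cite: JetchevSkinnerWan2017, §5.1] -/
theorem twin_exists_forall_C_pow_mul_mem_span_of_perLevelMemberTower_of_isTorsion
    (hSh : SkinnerUrban2014.prop323_XAc_equiv_XBigDecomp)
    (W' : WeierstrassCurve ℚ) [W'.IsElliptic] [W'.IsGloballyMinimal] (N' : ℕ)
    (K : Type) [Field K] [NumberField K]
    (hm : Mult W' 3) (hsurj : W'.HasSurjectiveModNGaloisRep 3) (hN : W'.conductorNorm ℤ = N')
    (hK : IsImaginaryQuadratic K) (hH : SatisfiesHeegnerHypothesis N' K)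
    (κ : ZpExtension K 3) (hκ : κ.IsAnticyclotomic) (γ : Field.absoluteGaloisGroup K) [Fact (κ.IsTopGenerator γ)]
    (𝔭' : HeightOneSpectrum (𝓞 K)) (h𝔭' : ((3 : ℕ) : 𝓞 K) ∈ 𝔭'.asIdeal)
    (hiv : ∀ Q : (W'.baseChange ℚ_[3]).toAffine.Point, 3 • Q = 0 → Q = 0)
    (hT₀ : Module.IsTorsion (IwasawaAlgebra 3) (AcSelmer.XAc (W'.baseChange K) 3 κ 𝔭' ∅ γ))
    (L : UnrSeries 3) (hμL : ∃ i : ℕ, IsUnit (PowerSeries.coeff i L))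
    (e : ℕ → ℕ) (hunb : ∀ n : ℕ, ∃ m : ℕ, 1 ≤ m ∧ e m + n ≤ m)
    (hmem : ∀ m : ℕ, 1 ≤ m →
      ∃ D : Skinner2016.HidaCongruentMember W' 3 m,
        ∀ [TopologicalSpace (PowerSeries (padicCoeffIntegers D.ι))]
          [ContinuousSMul (PowerSeries (padicCoeffIntegers D.ι))
            (BigRepModule (padicCoeffIntegers D.ι) 3 (Cofree D.Δ.ρ (padicCoeffField D.ι)))],
        ∀ (S₀ : Type) [CommRing S₀] (a : unrIntegers 3 →+* S₀) (b : padicCoeffIntegers D.ι →+* S₀)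
          (j : ℤ_[3] →+* unrIntegers 3),
          (∀ x : ℤ_[3], ((j x : unrIntegers 3) : ℂ_[3]) = algebraMap ℚ_[3] ℂ_[3] (x : ℚ_[3])) →
          a.comp j = b.comp (algebraMap ℤ_[3] (padicCoeffIntegers D.ι)) →
          ∃ Lm : PowerSeries S₀,
            (Module.IsTorsion (PowerSeries (padicCoeffIntegers D.ι))
                (XBig κ (D.Δ.cofreeRepOver K) 𝔭' (↑(W'.sigmaPlacesFinset 3 K))) →
              Ideal.span {((3 : ℕ) : PowerSeries S₀) ^ e m} *
                  (XBig.charIdeal κ (D.Δ.cofreeRepOver K) 𝔭' (↑(W'.sigmaPlacesFinset 3 K))).map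
                    (PowerSeries.map b) ≤ Ideal.span {Lm}) ∧
            Ideal.span {Lm} ≤
              Ideal.span {PowerSeries.map a (L * PowerSeries.map j (W'.sigmaEulerElement 3 K κ))} ⊔
                Ideal.span {((3 : ℕ) : PowerSeries S₀) ^ m}) :
    ∃ k : ℕ, ∀ G ∈ (AcSelmer.XAc.charIdeal (W'.baseChange K) 3 κ 𝔭' ∅ γ).map (PowerSeries.map (toUnr 3)),
      PowerSeries.C (((3 : ℕ) : unrIntegers 3) ^ k) * G ∈ Ideal.span {L} := by
  have hirr : Irr W' 3 := hasIrreducibleModPGaloisRep_of_hasSurjectiveModNGaloisRep W' 3 hsurj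
  have hsp : SplitsIn K 3 := hH 3 Nat.prime_three (hN ▸ dvd_conductorNorm_of_mult hm)
  obtain ⟨t, key⟩ := P2.RoadFF.exists_map_span_C_pow_mul_fittingIdeal_le_of_perLevelMemberTower_odd hSh W' 3 le_rfl
    K hK hirr hm hsp hiv κ hκ γ 𝔭' h𝔭' L hμL e hunb hmem
  obtain ⟨hSfin, hT, hPS, hX⟩ :=
    UniversalToricDescentTwinTorsionRankOne.twin_sigmaDataAt_of_isTorsion_empty' W' N' K hm hN hK hH κ hκ γ 𝔭' h𝔭' hT₀
  exact ⟨t, AcSelmer.XAc.forall_C_pow_mul_mem_span_of_map_span_mul_fittingIdeal_le (W'.baseChange K) 3 κ 𝔭' γ hSfin hT t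
    key hPS hX (dvd_refl _)⟩

end Summit.BirchSwinnertonDyer.Rank1Residual.X11b

end
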